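import Summits.BirchSwinnertonDyer.BirchSwinnertonDyer.Theorems.TeichmullerTwistDescentKOfRationalPrincipalSeries
import HarnessLib

/-!
# Route `TeichmullerTwistDescent`: «K₅», middle layer — from a nonzero equivariant functional on the spread lattice (over
# `ℚ_p` or `ℤ_p`) and the weight exclusion AT ONE INSTANCE `p ≥ 5` to the integral tame-type carrier functional with its socle clause

Cell `pub/bsd-wall` (D-0145 line route-BirchSwinnertonDyer-TeichmullerTwistDescent, OPEN rev 8), seat `bsd-line-ttd-p1` (prover 1/2,
g29).  THEOREMS ONLY; `--supports stmt-BirchSwinnertonDyer-24306`.  BSD is not proved by this file; no item is closed by it.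

WHAT.  Pointwise (`(p, M, W, D)` fixed, `5 ≤ p`) twins of three implications of the K-line whose tree statements carry the binder
`11 ≤ p` of K only as a threaded hypothesis (seat memo KLINE-CORNER-ttdp1g29.md §3):

* `exists_integral_of_rat` — (I1ℚ) ⟹ (I1⁰) at an instance: clear denominators of a nonzero equivariant `ℚ_p`-valued map on the
  finitely generated `Λ_Q(f)` (twin of `KOfPrincipalSeriesFunctional.tamePrincipalSeriesFunctional_of_rat`, any characters);
* `exists_borel_of_functional` — (I1⁰) ⟹ (I1‴) at an instance: the identity-coset coordinate of a nonzero equivariant `Ψ` is a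
  nonzero Borel eigenfunctional on the carrier killing `ker(spreadPeriod f)` (twin of
  `KOfPrincipalSeriesFunctional.nonzeroBorelEigenfunctional_of_tamePrincipalSeriesFunctional`, any characters);
* `exists_integralFunctional_of_borel_of_weightExclusion` — (I1‴) ∧ (W‴ at the instance) ⟹ the integral carrier functional with
  finite index and reduction socle `⊆ Sym^{2b} ⊗ det^{−b}`, `b = tameExponent p W`, `5 ≤ p` (twin of
  `KOfBorelEigenfunctional.integralTameTypeCarrierFunctional_of_borel_of_noEtaleWeightEigenQuotient`; Frobenius reciprocity,
  Jacobson–Nakayama, the socle alternative excluded by the weight exclusion).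

With `TeichmullerTwistDescentWeightExclusionFive` ((W‴)₅) and `TeichmullerTwistDescentKFiveOfCarrier` (the bottom) the sequel
`TeichmullerTwistDescentKFiveOfNamedInputs` assembles «K₅» = K's text with `5 ≤ p` from the five named inputs.
-/

set_option autoImplicit false
-- single-conjunct summit: `Summit.BirchSwinnertonDyer.BirchSwinnertonDyer.…` repeats the name by design
set_option linter.dupNamespace false

noncomputable section

open scoped Pointwise MatrixGroups TensorProduct

open Function CongruenceSubgroup
open Literature.RepresentationTheory.FiniteGroups Literature.RepresentationTheory.FiniteGroups.GL2
  Literature.NumberTheory.EllipticCurves.ModularForms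
open Literature.NumberTheory.EllipticCurves (Kato2004.teichmullerChar)
open Literature.NumberTheory.ModularSymbols Literature.NumberTheory.ModularSymbols.FullLevel
open Literature.Algebra.Homology
open Literature.NumberTheory.Automorphic (TwistedQuotient.resScalars TwistedQuotient.resScalars_apply)

namespace Summit.BirchSwinnertonDyer.BirchSwinnertonDyer.Theorems.TeichmullerTwistDescent

open WeierstrassCurve Literature.NumberTheory.EllipticCurves
open KOfPrincipalSeriesFunctional KOfBorelEigenfunctional

namespace KFive

variable (p M : ℕ) [hp : Fact p.Prime] [NeZero M] [NeZero (p ^ 2 * M)] (hpM : Nat.Coprime p M)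
  [Fintype (diagTorus (ZMod p))] [Invertible (Fintype.card (diagTorus (ZMod p)) : ℤ_[p])]

/-! ### (I1ℚ) ⟹ (I1⁰) at an instance -/

omit [NeZero (p ^ 2 * M)] in
/-- **Clearing denominators**: a nonzero `ℤ_p`-linear map from the spread lattice `Λ_Q(f)` to the `ℚ_p`-valued Bruhat model
`coordRep(χ₁, χ₂) ⊗ ℚ_p`, equivariant on spreads, gives a nonzero INTEGRAL equivariant map (`Λ_Q(f)` is finitely generated; multiply by a
common denominator; `coordReduce ℚ_p` is injective and intertwines). [cite: SerreLinearRepresentations1977, §15.2] -/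
theorem exists_integral_of_rat (f : CuspForm (Gamma0 (p ^ 2 * M)) 2) (χ₁ χ₂ : (ZMod p)ˣ →* ℤ_[p]ˣ)
    (Ψ : spreadLattice ℤ_[p] p M hpM f →ₗ[ℤ_[p]] (Option (ZMod p) → ℚ_[p]))
    (hΨ : IsEquivariantOnSpread ℤ_[p] p M hpM f
      (TwistedQuotient.resScalars ℤ_[p] (coordRep (reduceChar ℚ_[p] χ₁) (reduceChar ℚ_[p] χ₂))) Ψ)
    (hΨ0 : Ψ ≠ 0) :
    ∃ Ψ' : spreadLattice ℤ_[p] p M hpM f →ₗ[ℤ_[p]] (Option (ZMod p) → ℤ_[p]),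
      IsEquivariantOnSpread ℤ_[p] p M hpM f (coordRep χ₁ χ₂) Ψ' ∧ Ψ' ≠ 0 := by
  haveI := moduleFinite_spreadLattice p M hpM f
  obtain ⟨b, hb0, hb⟩ := exists_smul_isInteger p Ψ
  obtain ⟨Ψ', hΨ'⟩ := exists_integral_of_smul_isInteger p Ψ b hb
  refine ⟨Ψ', ?_, ?_⟩
  · intro F g
    apply coordReduce_padic_injective p
    rw [hΨ', coordReduce_coordRep, hΨ', hΨ F g, TwistedQuotient.resScalars_apply, LinearMap.map_smul_of_tower]
  · intro h0
    apply hΨ0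
    ext F o
    have h1 : (b • Ψ F) o = 0 := by
      rw [← hΨ', h0, LinearMap.zero_apply, map_zero, Pi.zero_apply]
    rw [Pi.smul_apply, Algebra.smul_def, PadicInt.algebraMap_apply, mul_eq_zero] at h1
    rcases h1 with h1 | h1
    · exact absurd (PadicInt.coe_eq_zero.mp h1) hb0
    · rw [h1, LinearMap.zero_apply, Pi.zero_apply]

/-! ### (I1⁰) ⟹ (I1‴) at an instance -/

omit [NeZero (p ^ 2 * M)] in
/-- **The identity-coset coordinate of a nonzero equivariant `Ψ : Λ_Q(f) → coordRep(χ₁, χ₂)` is a nonzero `(B, χ₁ ⊗ χ₂)`-eigenfunctional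
on the carrier killing `ker(spreadPeriod f)`** (`λ(z) := Ψ(Π z)(1)`, nonzero at a translate of a witness of `Ψ ≠ 0`).
[cite: SerreLinearRepresentations1977, §7.2 Prop. 21] [cite: Bump1997, §4.1 Eq. (1.6)–(1.7)] -/
theorem exists_borel_of_functional (f : CuspForm (Gamma0 (p ^ 2 * M)) 2) (χ₁ χ₂ : (ZMod p)ˣ →* ℤ_[p]ˣ)
    (Ψ : spreadLattice ℤ_[p] p M hpM f →ₗ[ℤ_[p]] (Option (ZMod p) → ℤ_[p]))
    (hΨ : IsEquivariantOnSpread ℤ_[p] p M hpM f (coordRep χ₁ χ₂) Ψ) (hΨ0 : Ψ ≠ 0) :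
    ∃ lam : H1carrier ℤ_[p] p M →ₗ[ℤ_[p]] ℤ_[p], lam ≠ 0 ∧
      (∀ (β : borel (ZMod p)) (z : H1carrier ℤ_[p] p M),
        lam (H1carrierRep ℤ_[p] p M (β : GL (Fin 2) (ZMod p)) z) = (borelCharacter (ZMod p) χ₁ χ₂ β : ℤ_[p]) * lam z) ∧
      ∀ z : H1carrier ℤ_[p] p M, spreadPeriod ℤ_[p] p M hpM f z = 0 → lam z = 0 := by
  -- a witness of `Ψ ≠ 0`, written as a spread, and a translate with nonzero identity coordinate
  obtain ⟨F, hF⟩ : ∃ F, Ψ F ≠ 0 := by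
    by_contra h
    push Not at h
    exact hΨ0 (LinearMap.ext fun F => by rw [h F, LinearMap.zero_apply])
  obtain ⟨z₀, hz₀⟩ : ∃ z, spreadElt ℤ_[p] p M hpM f z = F := by
    obtain ⟨z, hz⟩ := F.2
    exact ⟨z, Subtype.ext hz⟩
  subst hz₀
  obtain ⟨g, hg⟩ := exists_coordRep_apply_none_ne_zero χ₁ χ₂ hF
  -- `λ z := Ψ(Π z)(1)`
  let ev : (Option (ZMod p) → ℤ_[p]) →ₗ[ℤ_[p]] ℤ_[p] := LinearMap.proj none
  let lam : H1carrier ℤ_[p] p M →ₗ[ℤ_[p]] ℤ_[p] :=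
    ev.comp (Ψ.comp (LinearMap.rangeRestrict (spreadPeriod ℤ_[p] p M hpM f)))
  have hlam : ∀ z, lam z = Ψ (spreadElt ℤ_[p] p M hpM f z) none := fun z => rfl
  refine ⟨lam, ?_, ?_, ?_⟩
  · intro h0
    apply hg
    have h1 : lam (H1carrierRep ℤ_[p] p M g z₀) = 0 := by rw [h0, LinearMap.zero_apply]
    rwa [hlam, spreadElt_H1carrierRep, hΨ _ g] at h1
  · intro β z
    rw [hlam, hlam, spreadElt_H1carrierRep, hΨ _ (β : GL (Fin 2) (ZMod p)), coordRep_borel_apply_none]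
  · intro z hz
    have : spreadElt ℤ_[p] p M hpM f z = 0 := Subtype.ext (by rw [coe_spreadElt, hz]; rfl)
    rw [hlam, this, map_zero, Pi.zero_apply]

/-! ### (I1‴) ∧ (W‴ at the instance) ⟹ the integral carrier functional with its socle clause, `p ≥ 5` -/

/-- **The integral tame-type carrier functional at an instance `p ≥ 5` from a nonzero Borel eigenfunctional and the weight exclusion at
that instance** (twin of `KOfBorelEigenfunctional.integralTameTypeCarrierFunctional_of_borel_of_noEtaleWeightEigenQuotient` with `11 ≤ p`
weakened to `0 < b`, `2b < p − 1`, `b = tameExponent p W`).  Make `λ` primitive; Frobenius reciprocity gives an equivariant Hecke-eigen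
`Ψ₀ : C → L = coordRep(ω̃^{p−1−b}, ω̃ᵇ)` with `Ψ₀(z)(1) = λ(z)`; its image has nonzero reduction; were the reduction image not everything,
`C ↠ Sym^{2b} ⊗ (ω^{−b}∘det)` equivariantly and Hecke-eigen — excluded by `hW`; so `im Ψ₀ = L` (Jacobson–Nakayama), `Ψ₀` descends to
`Λ_Q(f_D)`, index `p⁰`, and `L` satisfies the reduction-socle condition.  BSD is not proved by this.
[cite: SerreLinearRepresentations1977, §7.2 Prop. 21, §15.1] [cite: EmertonGeeSavitt2015, §3.2, Lemma 4.1.1] -/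
theorem exists_integralFunctional_of_borel_of_weightExclusion (W : WeierstrassCurve ℚ) [W.IsElliptic] [W.IsGloballyMinimal]
    (D : ModularParametrizationData W (p ^ 2 * M))
    (hb : 0 < tameExponent p W) (hb2 : 2 * tameExponent p W < p - 1)
    (lam : H1carrier ℤ_[p] p M →ₗ[ℤ_[p]] ℤ_[p]) (hlam0 : lam ≠ 0)
    (hlamB : ∀ (β : borel (ZMod p)) (z : H1carrier ℤ_[p] p M),
      lam (H1carrierRep ℤ_[p] p M (β : GL (Fin 2) (ZMod p)) z) =
        (borelCharacter (ZMod p) (Kato2004.teichmullerChar p ^ (p - 1 - tameExponent p W))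
          (Kato2004.teichmullerChar p ^ tameExponent p W) β : ℤ_[p]) * lam z)
    (hlamK : ∀ z : H1carrier ℤ_[p] p M, spreadPeriod ℤ_[p] p M hpM D.f z = 0 → lam z = 0)
    (hW : letI : Algebra ℤ_[p] (ZMod p) := (PadicInt.toZMod (p := p)).toAlgebra
      ∀ Θ : H1carrier ℤ_[p] p M →ₗ[ℤ_[p]] ↥(MvPolynomial.homogeneousSubmodule (Fin 2) (ZMod p) (2 * tameExponent p W)),
      (∀ (g : GL (Fin 2) (ZMod p)) (z : H1carrier ℤ_[p] p M),
          Θ (H1carrierRep ℤ_[p] p M g z) =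
            symPowTwist (ZMod.castHom (dvd_refl p) (ZMod p))
              (reduceChar (ZMod p) (Kato2004.teichmullerChar p ^ (p - 1 - tameExponent p W)))
              (2 * tameExponent p W) g (Θ z)) →
      (∀ (q : ℕ) [NeZero q] (hq : q.Prime) (hqp : q ≠ p) (z : H1carrier ℤ_[p] p M),
          Θ (heckeT ℤ_[p] p M hq hqp z) = (((W.LFunction q : ℤ) : ZMod p)) • Θ z) →
      Θ = 0) :
    ∃ (m : ℕ) (Ψ : spreadLattice ℤ_[p] p M hpM D.f →ₗ[ℤ_[p]] (Option (ZMod p) → ℤ_[p])),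
      IsEquivariantOnSpread ℤ_[p] p M hpM D.f
        (coordRep (Kato2004.teichmullerChar p ^ (p - 1 - tameExponent p W)) (Kato2004.teichmullerChar p ^ tameExponent p W)) Ψ ∧
      (∀ v : Option (ZMod p) → ℤ_[p], (p : ℤ_[p]) ^ m • v ∈ LinearMap.range Ψ) ∧
      ∀ Λ' : Subrepresentation (coordRep (Kato2004.teichmullerChar p ^ (p - 1 - tameExponent p W))
          (Kato2004.teichmullerChar p ^ tameExponent p W)),
        Λ'.toSubmodule = LinearMap.range Ψ →
          @ReductionSocleLe p _ (ZMod p) _ _ (PadicInt.toZMod (p := p)).toAlgebra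
            (Kato2004.teichmullerChar p ^ (p - 1 - tameExponent p W)) (Kato2004.teichmullerChar p ^ tameExponent p W)
            (2 * tameExponent p W) Λ' := by
  letI : Algebra ℤ_[p] (ZMod p) := (PadicInt.toZMod (p := p)).toAlgebra
  -- coefficient data `ℤ_p → 𝔽_p`, `ϖ = p`
  have hsurj : Surjective (algebraMap ℤ_[p] (ZMod p)) := ZMod.ringHom_surjective _
  have hker : ∀ a : ℤ_[p], algebraMap ℤ_[p] (ZMod p) a = 0 ↔ (p : ℤ_[p]) ∣ a :=
    padicInt_algebraMap_eq_zero_iff p (padicInt_ker_eq_maximalIdeal p hsurj)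
  have halg : ∀ x : ℤ_[p], algebraMap ℤ_[p] (ZMod p) x = ZMod.castHom (dvd_refl p) (ZMod p) (PadicInt.toZMod x) := by
    intro x
    rw [ZMod.castHom_self, RingHom.id_apply]
    rfl
  have hreg : ∀ a : ℤ_[p], (p : ℤ_[p]) * a = 0 → a = 0 := padicInt_mul_eq_zero p
  have hsep : ∀ a : ℤ_[p], (∀ j : ℕ, (p : ℤ_[p]) ^ j ∣ a) → a = 0 := padicInt_eq_zero_of_forall_pow_dvd p
  have hjac : Ideal.span {(p : ℤ_[p])} ≤ (⊥ : Ideal ℤ_[p]).jacobson := by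
    rw [IsLocalRing.jacobson_eq_maximalIdeal ⊥ bot_ne_top, PadicInt.maximalIdeal_eq_span_p]
  set b := tameExponent p W with hbdef
  have hχne := TypeLatticeNoCaseOne.reduceChar_ne_of_exponents p halg hb hb2
  have hχ := TypeLatticeNoCaseOne.reduceChar_rel_of_exponents p halg (b := b) (by omega)
  -- a primitive eigenfunctional
  obtain ⟨c, lam₁, hlam₁, ⟨z₁, hz₁⟩, hlam₁K⟩ := exists_eq_pow_smul_primitive hreg hsep lam hlam0
  have hlam₁B : ∀ (β : borel (ZMod p)) (z : H1carrier ℤ_[p] p M),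
      lam₁ (H1carrierRep ℤ_[p] p M (β : GL (Fin 2) (ZMod p)) z) =
        (borelCharacter (ZMod p) (Kato2004.teichmullerChar p ^ (p - 1 - b)) (Kato2004.teichmullerChar p ^ b) β : ℤ_[p]) *
          lam₁ z := by
    intro β z
    have h := hlamB β z
    rw [hlam₁, hlam₁, mul_left_comm] at h
    exact mul_left_cancel₀ (pow_ne_zero c (NeZero.ne (p : ℤ_[p]))) h
  have hlam₁K' : ∀ z : H1carrier ℤ_[p] p M, spreadPeriod ℤ_[p] p M hpM D.f z = 0 → lam₁ z = 0 :=
    fun z hz => hlam₁K z (hlamK z hz)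
  -- `λ₁` is Hecke-eigen for `W`
  have hlam₁T : ∀ (q : ℕ) [NeZero q] (hq : q.Prime) (hqp : q ≠ p) (z : H1carrier ℤ_[p] p M),
      lam₁ (heckeT ℤ_[p] p M hq hqp z) = ((W.LFunction q : ℤ) : ℤ_[p]) * lam₁ z := by
    intro q _ hq hqp z
    have hcoef : (UpperHalfPlane.qExpansion 1 ⇑D.f).coeff q = ((W.LFunction q : ℤ) : ℂ) := D.isNewformOf.2 q
    have hT : HeckeRing0.toEnd (p ^ 2 * M) 2 (HeckeRing0.T (p ^ 2 * M) 2 q hq) D.f = ((W.LFunction q : ℤ) : ℂ) • D.f := by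
      rw [HeckeRing0.toEnd_T, D.isNewformOf.1.heckeT_eq_coeff_smul hq, hcoef]
    have h0 : spreadPeriod ℤ_[p] p M hpM D.f (heckeT ℤ_[p] p M hq hqp z - ((W.LFunction q : ℤ) : ℤ_[p]) • z) = 0 := by
      rw [map_sub, map_smul, spreadPeriod_heckeT ℤ_[p] p M hpM hq hqp hT z, sub_self]
    have := hlam₁K' _ h0
    rwa [map_sub, map_smul, smul_eq_mul, sub_eq_zero] at this
  -- Frobenius reciprocity: the equivariant map `Ψ₀ : C → L`
  let Ψ₀ : H1carrier ℤ_[p] p M →ₗ[ℤ_[p]] (Option (ZMod p) → ℤ_[p]) :=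
    frobeniusCoord (Kato2004.teichmullerChar p ^ (p - 1 - b)) (Kato2004.teichmullerChar p ^ b)
      (H1carrierRep ℤ_[p] p M) lam₁ hlam₁B
  have hΨ₀G : ∀ (g : GL (Fin 2) (ZMod p)) (z : H1carrier ℤ_[p] p M),
      Ψ₀ (H1carrierRep ℤ_[p] p M g z) =
        coordRep (Kato2004.teichmullerChar p ^ (p - 1 - b)) (Kato2004.teichmullerChar p ^ b) g (Ψ₀ z) :=
    fun g z => frobeniusCoord_apply_rep _ _ _ _ hlam₁B g z
  have hΨ₀T : ∀ (q : ℕ) [NeZero q] (hq : q.Prime) (hqp : q ≠ p) (z : H1carrier ℤ_[p] p M),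
      Ψ₀ (heckeT ℤ_[p] p M hq hqp z) = ((W.LFunction q : ℤ) : ℤ_[p]) • Ψ₀ z := by
    intro q _ hq hqp z
    funext o
    cases o with
    | none => rw [Pi.smul_apply, smul_eq_mul, frobeniusCoord_apply_none, frobeniusCoord_apply_none, hlam₁T]
    | some t =>
      rw [Pi.smul_apply, smul_eq_mul, frobeniusCoord_apply_some, frobeniusCoord_apply_some,
        ← heckeT_H1carrierRep, hlam₁T]
  have hΨ₀K : ∀ z : H1carrier ℤ_[p] p M, spreadPeriod ℤ_[p] p M hpM D.f z = 0 → Ψ₀ z = 0 := by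
    intro z hz
    refine frobeniusCoord_eq_zero_of _ _ _ _ hlam₁B (S := {z | spreadPeriod ℤ_[p] p M hpM D.f z = 0}) ?_ hlam₁K' hz
    intro g w hw
    change spreadPeriod ℤ_[p] p M hpM D.f (H1carrierRep ℤ_[p] p M g w) = 0
    have h := congrArg Subtype.val (spreadElt_H1carrierRep ℤ_[p] p M hpM D.f g w)
    rw [coe_spreadElt] at h
    rw [h]
    change funTranslate p g (spreadPeriod ℤ_[p] p M hpM D.f w) = 0
    rw [show spreadPeriod ℤ_[p] p M hpM D.f w = 0 from hw]
    rfl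
  -- the image lattice
  let Λ' : Subrepresentation (coordRep (Kato2004.teichmullerChar p ^ (p - 1 - b)) (Kato2004.teichmullerChar p ^ b)) :=
    { toSubmodule := LinearMap.range Ψ₀
      apply_mem_toSubmodule := fun g v hv => by
        obtain ⟨z, rfl⟩ := hv
        exact ⟨H1carrierRep ℤ_[p] p M g z, hΨ₀G g z⟩ }
  have hnz : ∃ v ∈ Λ', coordReduce (ZMod p) v ≠ 0 := by
    refine ⟨Ψ₀ z₁, ⟨z₁, rfl⟩, fun h => hz₁ ((hker _).mp ?_)⟩
    have := congr_fun h none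
    rwa [coordReduce_apply, frobeniusCoord_apply_none, Pi.zero_apply] at this
  -- `im Ψ₀ = L`
  have htop : Λ'.toSubmodule = ⊤ := by
    by_contra hne
    have hnt : ∃ w : Option (ZMod p) → ZMod p, ∀ v ∈ Λ', coordReduce (ZMod p) v ≠ w := by
      by_contra hall
      push Not at hall
      exact hne (toSubmodule_eq_top_of_forall_exists_coordReduce_eq_of_jacobson p _ _ hker hjac Λ' hall)
    obtain ⟨π, hπsurj, hπeq⟩ := exists_surjective_symPowTwist_of_reduction_ne p
      (Kato2004.teichmullerChar p ^ (p - 1 - b)) (Kato2004.teichmullerChar p ^ b) hsurj hχne hχ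
      (s := p - 1 - 2 * b) (by omega) Λ' hnz hnt
    let Θ : H1carrier ℤ_[p] p M →ₗ[ℤ_[p]] ↥(MvPolynomial.homogeneousSubmodule (Fin 2) (ZMod p) (2 * b)) :=
      π.comp Ψ₀.rangeRestrict
    have hΘG : ∀ (g : GL (Fin 2) (ZMod p)) (z : H1carrier ℤ_[p] p M),
        Θ (H1carrierRep ℤ_[p] p M g z) =
          symPowTwist (ZMod.castHom (dvd_refl p) (ZMod p))
            (reduceChar (ZMod p) (Kato2004.teichmullerChar p ^ (p - 1 - b))) (2 * b) g (Θ z) := by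
      intro g z
      change π (Ψ₀.rangeRestrict _) = symPowTwist _ _ _ g (π (Ψ₀.rangeRestrict z))
      rw [← hπeq g]
      congr 1
      exact Subtype.ext (hΨ₀G g z)
    have hΘT : ∀ (q : ℕ) [NeZero q] (hq : q.Prime) (hqp : q ≠ p) (z : H1carrier ℤ_[p] p M),
        Θ (heckeT ℤ_[p] p M hq hqp z) = (((W.LFunction q : ℤ) : ZMod p)) • Θ z := by
      intro q _ hq hqp z
      have hsm : Ψ₀.rangeRestrict (heckeT ℤ_[p] p M hq hqp z) = ((W.LFunction q : ℤ) : ℤ_[p]) • Ψ₀.rangeRestrict z :=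
        Subtype.ext (by rw [LinearMap.codRestrict_apply, Submodule.coe_smul, LinearMap.codRestrict_apply, hΨ₀T])
      change π (Ψ₀.rangeRestrict _) = _ • π (Ψ₀.rangeRestrict z)
      rw [hsm, map_smul, ← algebraMap_smul (ZMod p) ((W.LFunction q : ℤ) : ℤ_[p]), map_intCast]
    have h0 : Θ = 0 := hW Θ hΘG hΘT
    have hsurjΘ : Surjective Θ := hπsurj.comp (LinearMap.surjective_rangeRestrict Ψ₀)
    obtain ⟨x, hx⟩ := hsurjΘ ⟨MvPolynomial.X 0 ^ (2 * b), X_zero_pow_mem (2 * b)⟩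
    rw [h0, LinearMap.zero_apply] at hx
    exact pow_ne_zero (2 * b) (MvPolynomial.X_ne_zero (0 : Fin 2)) (congrArg Subtype.val hx).symm
  -- descend `Ψ₀` to `Λ_Q(f_D) = C / ker(spreadPeriod)`
  have hkerle : LinearMap.ker (spreadPeriod ℤ_[p] p M hpM D.f) ≤ LinearMap.ker Ψ₀ :=
    fun z hz => hΨ₀K z hz
  let Ψ : spreadLattice ℤ_[p] p M hpM D.f →ₗ[ℤ_[p]] (Option (ZMod p) → ℤ_[p]) :=
    ((LinearMap.ker (spreadPeriod ℤ_[p] p M hpM D.f)).liftQ Ψ₀ hkerle).comp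
      (spreadPeriod ℤ_[p] p M hpM D.f).quotKerEquivRange.symm.toLinearMap
  have hΨ : ∀ z, Ψ (spreadElt ℤ_[p] p M hpM D.f z) = Ψ₀ z := by
    intro z
    have hq : (spreadPeriod ℤ_[p] p M hpM D.f).quotKerEquivRange.symm (spreadElt ℤ_[p] p M hpM D.f z) =
        Submodule.Quotient.mk z := by
      rw [LinearEquiv.symm_apply_eq]
      exact Subtype.ext (by rw [LinearMap.quotKerEquivRange_apply_mk, coe_spreadElt])
    change (LinearMap.ker (spreadPeriod ℤ_[p] p M hpM D.f)).liftQ Ψ₀ hkerle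
      ((spreadPeriod ℤ_[p] p M hpM D.f).quotKerEquivRange.symm (spreadElt ℤ_[p] p M hpM D.f z)) = Ψ₀ z
    rw [hq, Submodule.liftQ_apply]
  have hΨeq : IsEquivariantOnSpread ℤ_[p] p M hpM D.f
      (coordRep (Kato2004.teichmullerChar p ^ (p - 1 - b)) (Kato2004.teichmullerChar p ^ b)) Ψ := by
    intro F g
    obtain ⟨z, hz⟩ : ∃ z, spreadElt ℤ_[p] p M hpM D.f z = F := by
      obtain ⟨z, hz⟩ := F.2
      exact ⟨z, Subtype.ext hz⟩
    subst hz
    rw [← spreadElt_H1carrierRep, hΨ, hΨ, hΨ₀G]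
  have hrange : LinearMap.range Ψ = ⊤ := by
    rw [eq_top_iff]
    rintro v -
    have hv : v ∈ Λ'.toSubmodule := by rw [htop]; exact Submodule.mem_top
    obtain ⟨z, rfl⟩ := hv
    exact ⟨spreadElt ℤ_[p] p M hpM D.f z, hΨ z⟩
  refine ⟨0, Ψ, hΨeq, fun v => ?_, ?_⟩
  · rw [pow_zero, one_smul, hrange]
    exact Submodule.mem_top
  · intro Λ'' hΛ''
    have htop'' : Λ''.toSubmodule = ⊤ := by rw [hΛ'', hrange]
    intro N hN hN0
    exact exists_injective_symPowTwist_of_toSubmodule_eq_top p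
      (Kato2004.teichmullerChar p ^ (p - 1 - b)) (Kato2004.teichmullerChar p ^ b) hker hsurj hχne hχ (by omega)
      Λ'' htop'' N hN hN0

end KFive

end Summit.BirchSwinnertonDyer.BirchSwinnertonDyer.Theorems.TeichmullerTwistDescent
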